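import Summits.ABC.StewartYu.PadicW80SizesB
import HarnessLib

/-!
# Cell abc-stewartyu, WP-A4/J2: the archimedean sizes at the `p`-adic parameter record, III

`Summits/ABC/StewartYu/PadicW80SizesC.lean` — continuation of `PadicW80Sizes(B).lean` (cell
`abc-stewartyu`, seat p3; theorems only): for `S : CW77.Setup` under `hy : S.SizeHyp P.Vs P.Vel P.Wb`
at p1's parameters,

* `abs_Dclear_qTerm_le_p` — Siegel's coefficient bound `|D(s,τ)·qTerm₀(u,τ,s)| ≤ 𝔅⁴E(2)` on the
  box of level `0`, `s < S₀`, `|τ| < T` (`E(c) = exp(c·𝔘/(2c_L'))`);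
* `abs_qTerm_le_p` — the archimedean half of the `p`-adic Liouville step:
  `|qTerm_J(u,τ,s)| ≤ 𝔅²E(2^{k+1})` on the box of level `J ≤ J₀`, `|τ| ≤ T`, `s < 2^{k+1+J}S₀`;
* `DclearJ_le_p` (`D_J(s,τ) ≤ 𝔅²E(2^{k+1})`), `abs_rHalf_le_p`, `Dhalf_le_p` (`≤ 𝔅²E(2)` at the
  half points `s < 2^{J+1}S₀` of level `J < J₀`).

The proofs are those of `Waldschmidt1980SizesB.lean`.  Everything is [folklore] book-keeping on
[cite: Waldschmidt1980, Lemma 3.2 (pp. 266–267), §3.4 (3.21)–(3.22) (pp. 269–270)].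
-/

noncomputable section

open Finset Real
open Literature.NumberTheory.Transcendental
open Literature.NumberTheory.Transcendental.Baker1975
open Literature.NumberTheory.Transcendental.Baker1975.Ch3
open Literature.NumberTheory.Transcendental.CW77

namespace Literature.NumberTheory.Transcendental.CW77

namespace Setup

open Summit.ABC.StewartYu
open Summit.ABC.StewartYu.PadicW80Par (cLp' cTp cLp mRp)

variable {S : Setup} {P : PadicW80Par S.d} (hy : S.SizeHyp P.Vs P.Vel P.Wb)
include hy

/-- **The bound `Amax = 𝔅⁴ E(2)` of Siegel's step** at the `p`-adic parameters:
`|D(s,τ) · qTerm| ≤ 𝔅⁴ exp(2𝔘/(2c_L'))` on the box of level `0`, `s < S₀ᵖ`, `|τ| < T`.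
[cite: Waldschmidt1980, Lemma 3.2 (pp. 266–267)] -/
theorem SizeHyp.abs_Dclear_qTerm_le_p {s : ℕ} (hs : s < P.S₀p) {τ : Tau S.d} (hτ : tauNorm τ < P.Tp)
    {u : Idx S.d P.hparp P.Lbp} (hu : u ∈ S.box (h := P.hparp) (Lb := P.Lbp) P.Lp P.Lθp 0) :
    |((S.Dclear (h := P.hparp) P.J₀p P.Lp P.Lθp s τ : ℕ) : ℝ) *
        (S.qTerm (h := P.hparp) P.J₀p 0 u τ s : ℝ)| ≤
      P.𝔅p ^ 4 * Real.exp (2 * (P.𝔘p / (2 * cLp'))) := by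
  have hτ1 : τ.1 ≤ P.Tp := by unfold tauNorm at hτ; omega
  have hτ2 : ∑ j, τ.2 j ≤ P.Tp := by unfold tauNorm at hτ; omega
  have hs' : s ≤ 2 ^ (S.d + 1 + 0) * P.S₀p := by
    have : P.S₀p ≤ 2 ^ (S.d + 1 + 0) * P.S₀p := Nat.le_mul_of_pos_left _ (Nat.pow_pos two_pos)
    omega
  have hs1 : s ≤ 2 ^ 0 * (1 * P.S₀p) := by simp; omega
  have hx : ((scale P.J₀p 0 * s : ℕ) : ℝ) ≤ P.Xptp := S.scale_mul_le_Xptp P (Nat.zero_le _) hs'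
  have h𝔅 := P.𝔅_pos
  -- the denominator `≤ 𝔅² E₁`
  have hD : ((S.Dclear (h := P.hparp) P.J₀p P.Lp P.Lθp s τ : ℕ) : ℝ) ≤
      P.𝔅p ^ 2 * Real.exp (1 * (P.𝔘p / (2 * cLp'))) := by
    unfold Dclear
    rw [Nat.cast_mul, Nat.cast_mul]
    have h1 : ((nuBound (scale P.J₀p 0 * s) P.hparp ^ τ.1 : ℕ) : ℝ) ≤ P.𝔅p ^ 1 := by
      rw [Nat.cast_pow, pow_one]; exact P.nuBound_pow_le_𝔅_p hx hτ1
    have h2 : ((S.bθ.natAbs ^ (∑ j, τ.2 j) : ℕ) : ℝ) ≤ P.𝔅p ^ 1 := by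
      rw [pow_one]; exact hy.natAbs_bθ_pow_le_p hτ2
    have h3 : (((∏ j, (S.α j).den ^ (P.Lp j * s)) * S.θ.den ^ (P.Lθp * s) : ℕ) : ℝ) ≤
        Real.exp (1 * (P.𝔘p / (2 * cLp'))) := by
      have key := hy.den_prod_le_p (c := 1) (e := fun j => P.Lp j * s) (eθ := P.Lθp * s)
        (fun j => by rw [one_mul]; exact Nat.mul_le_mul_left _ hs.le)
        (by rw [one_mul]; exact Nat.mul_le_mul_left _ hs.le)
      push_cast at key ⊢
      exact key
    have h12 := P.mul_le_𝔅_pow_p h1 h2 (Nat.cast_nonneg _)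
    exact mul_le_mul h12 h3 (Nat.cast_nonneg _) (by positivity)
  -- the term `≤ 𝔅² E₁`
  have hQ : |(S.qTerm (h := P.hparp) P.J₀p 0 u τ s : ℝ)| ≤ P.𝔅p ^ 2 * Real.exp (1 * (P.𝔘p / (2 * cLp'))) := by
    unfold qTerm; push_cast
    rw [abs_mul, abs_mul]
    have h1 : |(S.qΔ (h := P.hparp) P.J₀p 0 u τ.1 s : ℝ)| ≤ P.𝔅p ^ 1 := by
      rw [pow_one]; exact S.abs_qΔ_le_p P (Nat.zero_le _) u hs' hτ1
    have h2 : |(S.qA u τ.2 : ℝ)| ≤ P.𝔅p ^ 1 := by rw [pow_one]; exact hy.abs_qA_le_p hu hτ2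
    have h3 : |(S.qE u s : ℝ)| ≤ Real.exp ((1 : ℕ) * (P.𝔘p / (2 * cLp'))) := hy.abs_qE_le_p hu hs1
    rw [Nat.cast_one] at h3
    have h12 := P.mul_le_𝔅_pow_p h1 h2 (abs_nonneg _)
    exact mul_le_mul h12 h3 (abs_nonneg _) (by positivity)
  rw [abs_mul, Nat.abs_cast]
  calc ((S.Dclear (h := P.hparp) P.J₀p P.Lp P.Lθp s τ : ℕ) : ℝ) * |(S.qTerm (h := P.hparp) P.J₀p 0 u τ s : ℝ)|
      ≤ (P.𝔅p ^ 2 * Real.exp (1 * (P.𝔘p / (2 * cLp')))) * (P.𝔅p ^ 2 * Real.exp (1 * (P.𝔘p / (2 * cLp')))) :=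
        mul_le_mul hD hQ (abs_nonneg _) (by positivity)
    _ = P.𝔅p ^ 4 * Real.exp (2 * (P.𝔘p / (2 * cLp'))) := by
        rw [show (2 : ℝ) * (P.𝔘p / (2 * cLp')) = 1 * (P.𝔘p / (2 * cLp')) + 1 * (P.𝔘p / (2 * cLp')) by ring,
          Real.exp_add]; ring

/-- **`|qTerm_J(u,τ,s)| ≤ 𝔅² E(2^{k+1})`** — the archimedean size of one term of `φ_{J,τ}(s)` at an
integer point of the `k`-th inner step: box of level `J ≤ J₀ᵖ`, `|τ| ≤ T`, `s < 2^{k+1+J} S₀ᵖ`,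
`k ≤ d` (`|qΔ| ≤ 𝔅`, `|qA| ≤ 𝔅`, `|qE| ≤ E(2^{k+1})`).  This is the archimedean half of the
`p`-adic Liouville estimate (product formula). [cite: Waldschmidt1980, §3.4 (3.21) (p. 269)]
[cite: Yu1990, §3 (p. 40)] -/
theorem SizeHyp.abs_qTerm_le_p {J k : ℕ} (hJ : J ≤ P.J₀p) (hk : k ≤ S.d) {u : Idx S.d P.hparp P.Lbp}
    (hu : u ∈ S.box (h := P.hparp) (Lb := P.Lbp) P.Lp P.Lθp J) {τ : Tau S.d} (hτ : tauNorm τ ≤ P.Tp)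
    {s : ℕ} (hs : s < 2 ^ (k + 1 + J) * P.S₀p) :
    |(S.qTerm (h := P.hparp) P.J₀p J u τ s : ℝ)| ≤
      P.𝔅p ^ 2 * Real.exp ((2 ^ (k + 1) : ℕ) * (P.𝔘p / (2 * cLp'))) := by
  have hτ1 : τ.1 ≤ P.Tp := by unfold tauNorm at hτ; omega
  have hτ2 : ∑ j, τ.2 j ≤ P.Tp := by unfold tauNorm at hτ; omega
  have hs' : s ≤ 2 ^ (S.d + 1 + J) * P.S₀p := by
    have : 2 ^ (k + 1 + J) * P.S₀p ≤ 2 ^ (S.d + 1 + J) * P.S₀p :=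
      Nat.mul_le_mul_right _ (Nat.pow_le_pow_right two_pos (by omega))
    omega
  have hs2 : s ≤ 2 ^ J * (2 ^ (k + 1) * P.S₀p) := by
    rw [← Nat.mul_assoc, ← pow_add, Nat.add_comm J (k + 1)]; exact hs.le
  unfold qTerm; push_cast
  rw [abs_mul, abs_mul]
  have h1 : |(S.qΔ (h := P.hparp) P.J₀p J u τ.1 s : ℝ)| ≤ P.𝔅p ^ 1 := by
    rw [pow_one]; exact S.abs_qΔ_le_p P hJ u hs' hτ1
  have h2 : |(S.qA u τ.2 : ℝ)| ≤ P.𝔅p ^ 1 := by rw [pow_one]; exact hy.abs_qA_le_p hu hτ2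
  have h3 : |(S.qE u s : ℝ)| ≤ Real.exp ((2 ^ (k + 1) : ℕ) * (P.𝔘p / (2 * cLp'))) := hy.abs_qE_le_p hu hs2
  push_cast at h3
  have h12 := P.mul_le_𝔅_pow_p h1 h2 (abs_nonneg _)
  exact mul_le_mul h12 h3 (abs_nonneg _) (by positivity)

/-- **`D_J(s,τ) ≤ 𝔅² E(2^{k+1})`** at level `J ≤ J₀ᵖ` for the integer points `s < 2^{k+1+J} S₀ᵖ`
(`k ≤ d`), `|τ| ≤ T`. [cite: Waldschmidt1980, §3.4 (3.21) (p. 269)] -/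
theorem SizeHyp.DclearJ_le_p {J k : ℕ} (hJ : J ≤ P.J₀p) (hk : k ≤ S.d) {τ : Tau S.d} (hτ : tauNorm τ ≤ P.Tp)
    {s : ℕ} (hs : s < 2 ^ (k + 1 + J) * P.S₀p) :
    ((S.DclearJ (h := P.hparp) P.J₀p J P.Lp P.Lθp s τ : ℕ) : ℝ) ≤
      P.𝔅p ^ 2 * Real.exp ((2 ^ (k + 1) : ℕ) * (P.𝔘p / (2 * cLp'))) := by
  have hτ1 : τ.1 ≤ P.Tp := by unfold tauNorm at hτ; omega
  have hτ2 : ∑ j, τ.2 j ≤ P.Tp := by unfold tauNorm at hτ; omega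
  have hs' : s ≤ 2 ^ (S.d + 1 + J) * P.S₀p := by
    have : 2 ^ (k + 1 + J) * P.S₀p ≤ 2 ^ (S.d + 1 + J) * P.S₀p :=
      Nat.mul_le_mul_right _ (Nat.pow_le_pow_right two_pos (by omega))
    omega
  have hx : ((scale P.J₀p J * s : ℕ) : ℝ) ≤ P.Xptp := S.scale_mul_le_Xptp P hJ hs'
  unfold DclearJ
  rw [Nat.cast_mul, Nat.cast_mul]
  have h1 : ((nuBound (scale P.J₀p J * s) P.hparp ^ τ.1 : ℕ) : ℝ) ≤ P.𝔅p ^ 1 := by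
    rw [Nat.cast_pow, pow_one]; exact P.nuBound_pow_le_𝔅_p hx hτ1
  have h2 : ((S.bθ.natAbs ^ (∑ j, τ.2 j) : ℕ) : ℝ) ≤ P.𝔅p ^ 1 := by
    rw [pow_one]; exact hy.natAbs_bθ_pow_le_p hτ2
  have hdiv : ∀ Lq : ℕ, Lq / 2 ^ J * s ≤ 2 ^ (k + 1) * Lq * P.S₀p := by
    intro Lq
    calc Lq / 2 ^ J * s ≤ (Lq / 2 ^ J) * (2 ^ (k + 1 + J) * P.S₀p) := Nat.mul_le_mul_left _ hs.le
      _ = 2 ^ (k + 1) * ((Lq / 2 ^ J) * 2 ^ J) * P.S₀p := by rw [pow_add]; ring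
      _ ≤ 2 ^ (k + 1) * Lq * P.S₀p := by
          have := Nat.div_mul_le_self Lq (2 ^ J)
          exact Nat.mul_le_mul_right _ (Nat.mul_le_mul_left _ this)
  have h3 : (((∏ j, (S.α j).den ^ (P.Lp j / 2 ^ J * s)) * S.θ.den ^ (P.Lθp / 2 ^ J * s) : ℕ) : ℝ) ≤
      Real.exp ((2 ^ (k + 1) : ℕ) * (P.𝔘p / (2 * cLp'))) :=
    hy.den_prod_le_p (c := 2 ^ (k + 1)) (fun j => hdiv (P.Lp j)) (hdiv P.Lθp)
  have h12 := P.mul_le_𝔅_pow_p h1 h2 (Nat.cast_nonneg _)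
  exact mul_le_mul h12 h3 (Nat.cast_nonneg _) (by positivity)

/-- **`|rHalf| ≤ 𝔅² E(2)`** on the box of level `J < J₀ᵖ`, `|τ| ≤ T`, `s < 2^{J+1} S₀ᵖ`.
[cite: Waldschmidt1980, §3.4 (3.22) (p. 270)] -/
theorem SizeHyp.abs_rHalf_le_p {J : ℕ} (hJ : J < P.J₀p) {u : Idx S.d P.hparp P.Lbp}
    (hu : u ∈ S.box (h := P.hparp) (Lb := P.Lbp) P.Lp P.Lθp J) {τ : Tau S.d} (hτ : tauNorm τ ≤ P.Tp)
    {s : ℕ} (hs : s < 2 ^ (J + 1) * P.S₀p) :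
    |(S.rHalf (h := P.hparp) P.J₀p J u τ s : ℝ)| ≤ P.𝔅p ^ 2 * Real.exp (2 * (P.𝔘p / (2 * cLp'))) := by
  have hτ1 : τ.1 ≤ P.Tp := by unfold tauNorm at hτ; omega
  have hτ2 : ∑ j, τ.2 j ≤ P.Tp := by unfold tauNorm at hτ; omega
  have hs' : s ≤ 2 ^ (S.d + 1 + (J + 1)) * P.S₀p := by
    have : 2 ^ (J + 1) * P.S₀p ≤ 2 ^ (S.d + 1 + (J + 1)) * P.S₀p :=
      Nat.mul_le_mul_right _ (Nat.pow_le_pow_right two_pos (by omega))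
    omega
  have hs2 : s ≤ 2 ^ J * (2 * P.S₀p) := by rw [← Nat.mul_assoc, ← pow_succ]; exact hs.le
  unfold rHalf; push_cast
  rw [abs_mul, abs_mul]
  have h1 : |(S.qΔ (h := P.hparp) P.J₀p (J + 1) u τ.1 s : ℝ)| ≤ P.𝔅p ^ 1 := by
    rw [pow_one]; exact S.abs_qΔ_le_p P hJ u hs' hτ1
  have h2 : |(S.qA u τ.2 : ℝ)| ≤ P.𝔅p ^ 1 := by rw [pow_one]; exact hy.abs_qA_le_p hu hτ2
  have h3 : |(S.qEh u s : ℝ)| ≤ Real.exp ((2 : ℕ) * (P.𝔘p / (2 * cLp'))) := hy.abs_qEh_le_p hu hs2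
  rw [Nat.cast_ofNat] at h3
  have h12 := P.mul_le_𝔅_pow_p h1 h2 (abs_nonneg _)
  exact mul_le_mul h12 h3 (abs_nonneg _) (by positivity)

/-- **`Dhalf ≤ 𝔅² E(2)`** for `J < J₀ᵖ`, `|τ| ≤ T`, `s < 2^{J+1} S₀ᵖ`.
[cite: Waldschmidt1980, §3.4 (3.22) (p. 270)] -/
theorem SizeHyp.Dhalf_le_p {J : ℕ} (hJ : J < P.J₀p) {τ : Tau S.d} (hτ : tauNorm τ ≤ P.Tp)
    {s : ℕ} (hs : s < 2 ^ (J + 1) * P.S₀p) :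
    ((S.Dhalf (h := P.hparp) P.J₀p J P.Lp P.Lθp s τ : ℕ) : ℝ) ≤
      P.𝔅p ^ 2 * Real.exp (2 * (P.𝔘p / (2 * cLp'))) := by
  have hτ1 : τ.1 ≤ P.Tp := by unfold tauNorm at hτ; omega
  have hτ2 : ∑ j, τ.2 j ≤ P.Tp := by unfold tauNorm at hτ; omega
  have hs' : s ≤ 2 ^ (S.d + 1 + (J + 1)) * P.S₀p := by
    have : 2 ^ (J + 1) * P.S₀p ≤ 2 ^ (S.d + 1 + (J + 1)) * P.S₀p :=
      Nat.mul_le_mul_right _ (Nat.pow_le_pow_right two_pos (by omega))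
    omega
  have hx : ((scale P.J₀p (J + 1) * s : ℕ) : ℝ) ≤ P.Xptp := S.scale_mul_le_Xptp P hJ hs'
  unfold Dhalf
  rw [Nat.cast_mul, Nat.cast_mul]
  have h1 : ((nuBound (scale P.J₀p (J + 1) * s) P.hparp ^ τ.1 : ℕ) : ℝ) ≤ P.𝔅p ^ 1 := by
    rw [Nat.cast_pow, pow_one]; exact P.nuBound_pow_le_𝔅_p hx hτ1
  have h2 : ((S.bθ.natAbs ^ (∑ j, τ.2 j) : ℕ) : ℝ) ≤ P.𝔅p ^ 1 := by
    rw [pow_one]; exact hy.natAbs_bθ_pow_le_p hτ2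
  have hdiv : ∀ Lq : ℕ, Lq / 2 ^ J * s ≤ 2 * Lq * P.S₀p := by
    intro Lq
    calc Lq / 2 ^ J * s ≤ (Lq / 2 ^ J) * (2 ^ (J + 1) * P.S₀p) := Nat.mul_le_mul_left _ hs.le
      _ = 2 * ((Lq / 2 ^ J) * 2 ^ J) * P.S₀p := by rw [pow_succ]; ring
      _ ≤ 2 * Lq * P.S₀p := by
          have := Nat.div_mul_le_self Lq (2 ^ J)
          exact Nat.mul_le_mul_right _ (Nat.mul_le_mul_left _ this)
  have h3 : (((∏ j, (S.α j).den ^ (P.Lp j / 2 ^ J * s)) * S.θ.den ^ (P.Lθp / 2 ^ J * s) : ℕ) : ℝ) ≤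
      Real.exp (2 * (P.𝔘p / (2 * cLp'))) := by
    have := hy.den_prod_le_p (c := 2) (fun j => hdiv (P.Lp j)) (hdiv P.Lθp)
    push_cast at this ⊢
    exact this
  have h12 := P.mul_le_𝔅_pow_p h1 h2 (Nat.cast_nonneg _)
  exact mul_le_mul h12 h3 (Nat.cast_nonneg _) (by positivity)

end Setup

end Literature.NumberTheory.Transcendental.CW77

end
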